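/-
Copyright (c) 2026. All rights reserved.
Released under Apache 2.0 license as described in the file LICENSE.
Authors: abc-iut cell — seat abc-iut-L4-t8 (wave 2, L4 discharge; proof-only support for the §2
facts typed by abc-iut-L4-t2 in `AutHolomorphicSpaces.lean`; consumes abc-iut-L4-t7's
`AutHolomorphicSpacesHolTypeProofs`).
-/
import Literature.AnabelianGeometry.AbsoluteAnabelian.AutHolomorphicSpacesHolTypeProofs
import Mathlib.Geometry.Manifold.MFDeriv.Atlas
import Mathlib.Geometry.Manifold.MFDeriv.FDeriv
import Mathlib.Analysis.Calculus.Deriv.Star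
import HarnessLib

/-!
# Calculus of holomorphic / anti-holomorphic points on Riemann surfaces ([AbsTopIII] Def 2.1 (ii))

PROOF-ONLY support for the §2 facts of S. Mochizuki, *Topics in absolute anabelian geometry III*
typed in `AutHolomorphicSpaces.lean` (abc-iut-L4-t2): the "RC-holomorphic" calculus of
Def 2.1 (ii) p.51 ([Mzk14] Def 1.1 (vi)) — a map of Riemann surfaces is RC-holomorphic when it is
holomorphic (`IsHolAt`) or anti-holomorphic (`IsAntiHolAt`) near each point.  We prove the
elementary rules that the §2 discharges use and that Mathlib does not provide for anti-holomorphic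
maps (the holomorphic ones are Mathlib's `MDifferentiableAt.comp` etc.):

* `IsAntiHolAt.eventually_differentiableAt_conj_charts` — anti-holomorphy, defined through the
  preferred charts, can be read in ANY charts of the analytic atlases (transition maps are
  holomorphic; `conj ∘ τ ∘ conj` is holomorphic when `τ` is, Mathlib `DifferentiableAt.conj_conj`);
* composition: `IsHolAt.comp`, `IsHolAt.comp_isAntiHolAt` (hol ∘ anti = anti),
  `IsAntiHolAt.comp_isHolAt` (anti ∘ hol = anti), `IsAntiHolAt.comp_isAntiHolAt`
  (anti ∘ anti = hol);
* inverses of homeomorphisms (unconditional) are in `RCHolomorphicInverse.lean`.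

Refereed pre-IUT material; nothing here bears on the disputed [IUTchIII] Cor. 3.12; no side taken.
-/

noncomputable section

namespace Literature.AnabelianGeometry.AbsoluteAnabelian

universe u

open _root_.TopologicalSpace _root_.Topology _root_.Set _root_.Metric _root_.Function _root_.Filter
open scoped _root_.Manifold _root_.ContDiff ComplexConjugate

section Calculus

variable {X Y Z : Type u} [TopologicalSpace X] [ChartedSpace ℂ X] [IsManifold 𝓘(ℂ, ℂ) ω X]
  [TopologicalSpace Y] [ChartedSpace ℂ Y] [IsManifold 𝓘(ℂ, ℂ) ω Y]
  [TopologicalSpace Z] [ChartedSpace ℂ Z] [IsManifold 𝓘(ℂ, ℂ) ω Z]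

/-! ### Chart bookkeeping -/

omit [IsManifold 𝓘(ℂ, ℂ) ω X] [IsManifold 𝓘(ℂ, ℂ) ω Y] in
/-- The chart expression of `f` at `x` unfolded: `w ↦ c_{f x} (f (c_x⁻¹ w))`.
[cite: MochizukiAbsTopIII2015, Definition 2.1 (ii) p.51] -/
theorem writtenInExtChartAt_apply_eq (f : X → Y) (x : X) (w : ℂ) :
    writtenInExtChartAt 𝓘(ℂ, ℂ) 𝓘(ℂ, ℂ) x f w = chartAt ℂ (f x) (f ((chartAt ℂ x).symm w)) := by
  simp [writtenInExtChartAt]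

omit [ChartedSpace ℂ Y] [IsManifold 𝓘(ℂ, ℂ) ω X] [IsManifold 𝓘(ℂ, ℂ) ω Y] [TopologicalSpace Y] in
/-- The extended chart at `x` is the preferred chart at `x`.
[cite: MochizukiAbsTopIII2015, Definition 2.1 (ii) p.51] -/
theorem extChartAt_apply_eq (x y : X) : extChartAt 𝓘(ℂ, ℂ) x y = chartAt ℂ x y := by
  simp

omit [IsManifold 𝓘(ℂ, ℂ) ω X] [IsManifold 𝓘(ℂ, ℂ) ω Y] in
/-- The chart expression of `f` at `x`, evaluated at the base point, is `c_{f x} (f x)`.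
[cite: MochizukiAbsTopIII2015, Definition 2.1 (ii) p.51] -/
theorem writtenInExtChartAt_apply_self (f : X → Y) (x : X) :
    writtenInExtChartAt 𝓘(ℂ, ℂ) 𝓘(ℂ, ℂ) x f (extChartAt 𝓘(ℂ, ℂ) x x) = chartAt ℂ (f x) (f x) := by
  rw [extChartAt_apply_eq, writtenInExtChartAt_apply_eq,
    (chartAt ℂ x).left_inv (mem_chart_source ℂ x)]

omit [ChartedSpace ℂ Y] [IsManifold 𝓘(ℂ, ℂ) ω Y] [TopologicalSpace Y] in
/-- **Transition maps of the analytic atlas are holomorphic**: for charts `a`, `c` of the atlas of a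
Riemann surface, `c ∘ a⁻¹` is `ℂ`-differentiable at every `z ∈ a.target` with `a⁻¹ z ∈ c.source`.
[cite: MochizukiAbsTopIII2015, Definition 2.1 (i) p.50] -/
theorem differentiableAt_chart_transition {a c : OpenPartialHomeomorph X ℂ} (ha : a ∈ atlas ℂ X)
    (hc : c ∈ atlas ℂ X) {z : ℂ} (hz : z ∈ a.target) (hz' : a.symm z ∈ c.source) :
    DifferentiableAt ℂ (c ∘ a.symm) z := by
  have h1 : MDifferentiableAt 𝓘(ℂ, ℂ) 𝓘(ℂ, ℂ) a.symm z := mdifferentiableAt_atlas_symm ha hz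
  have h2 : MDifferentiableAt 𝓘(ℂ, ℂ) 𝓘(ℂ, ℂ) c (a.symm z) := mdifferentiableAt_atlas hc hz'
  exact mdifferentiableAt_iff_differentiableAt.1 (h2.comp z h1)

/-! ### Basic properties of `IsHolAt` / `IsAntiHolAt` -/

omit [IsManifold 𝓘(ℂ, ℂ) ω X] [IsManifold 𝓘(ℂ, ℂ) ω Y] in
/-- A map holomorphic at `x` is `ℂ`-differentiable at `x`.
[cite: MochizukiAbsTopIII2015, Definition 2.1 (ii) p.51] -/
theorem IsHolAt.mdifferentiableAt {f : X → Y} {x : X} (h : IsHolAt f x) :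
    MDifferentiableAt 𝓘(ℂ, ℂ) 𝓘(ℂ, ℂ) f x :=
  h.self_of_nhds

omit [IsManifold 𝓘(ℂ, ℂ) ω X] [IsManifold 𝓘(ℂ, ℂ) ω Y] in
/-- A map holomorphic at `x` is continuous at `x`.
[cite: MochizukiAbsTopIII2015, Definition 2.1 (ii) p.51] -/
theorem IsHolAt.continuousAt {f : X → Y} {x : X} (h : IsHolAt f x) : ContinuousAt f x :=
  h.mdifferentiableAt.continuousAt

omit [IsManifold 𝓘(ℂ, ℂ) ω X] [IsManifold 𝓘(ℂ, ℂ) ω Y] in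
/-- A map anti-holomorphic at `x` is continuous at `x`.
[cite: MochizukiAbsTopIII2015, Definition 2.1 (ii) p.51] -/
theorem IsAntiHolAt.continuousAt {f : X → Y} {x : X} (h : IsAntiHolAt f x) : ContinuousAt f x :=
  (h.self_of_nhds).1

omit [IsManifold 𝓘(ℂ, ℂ) ω X] [IsManifold 𝓘(ℂ, ℂ) ω Y] in
/-- Holomorphy at a point propagates to nearby points.
[cite: MochizukiAbsTopIII2015, Definition 2.1 (ii) p.51] -/
theorem IsHolAt.eventually {f : X → Y} {x : X} (h : IsHolAt f x) : ∀ᶠ y in 𝓝 x, IsHolAt f y :=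
  h.eventually_nhds

omit [IsManifold 𝓘(ℂ, ℂ) ω X] [IsManifold 𝓘(ℂ, ℂ) ω Y] in
/-- Anti-holomorphy at a point propagates to nearby points.
[cite: MochizukiAbsTopIII2015, Definition 2.1 (ii) p.51] -/
theorem IsAntiHolAt.eventually {f : X → Y} {x : X} (h : IsAntiHolAt f x) :
    ∀ᶠ y in 𝓝 x, IsAntiHolAt f y :=
  h.eventually_nhds

/-! ### Anti-holomorphy read in arbitrary charts -/

/-- **Anti-holomorphy is chart-independent.**  If `f` is anti-holomorphic at `x`, then near `x`, for
ANY charts `a` of `X` and `b` of `Y` (members of the analytic atlases) around the point and its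
image,
`conj ∘ (b ∘ f ∘ a⁻¹)` is `ℂ`-differentiable at the chart image of the point: the preferred-chart
expression differs from the `(a, b)`-expression by holomorphic transition maps `τ, τ'`, and
`conj ∘ τ' ∘ W ∘ τ = (conj ∘ τ' ∘ conj) ∘ (conj ∘ W) ∘ τ` with `conj ∘ τ' ∘ conj` holomorphic.
[cite: MochizukiAbsTopIII2015, Definition 2.1 (ii) p.51] -/
theorem IsAntiHolAt.eventually_differentiableAt_conj_charts {f : X → Y} {x : X}
    (h : IsAntiHolAt f x) :
    ∀ᶠ y in 𝓝 x, ∀ (a : OpenPartialHomeomorph X ℂ) (b : OpenPartialHomeomorph Y ℂ),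
      a ∈ atlas ℂ X → b ∈ atlas ℂ Y → y ∈ a.source → f y ∈ b.source →
      DifferentiableAt ℂ (conj ∘ (b ∘ f ∘ a.symm)) (a y) := by
  filter_upwards [h] with y hy
  obtain ⟨hcont, hdiff⟩ := hy
  intro a b ha hb hya hyb
  set c₀ := chartAt ℂ y with hc₀
  set d₀ := chartAt ℂ (f y) with hd₀
  set W := writtenInExtChartAt 𝓘(ℂ, ℂ) 𝓘(ℂ, ℂ) y f with hWdef
  have hW : ∀ w, W w = d₀ (f (c₀.symm w)) := fun w => by
    simp [hWdef, writtenInExtChartAt, hc₀, hd₀]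
  have hpt : extChartAt 𝓘(ℂ, ℂ) y y = c₀ y := by simp [hc₀]
  rw [hpt] at hdiff
  set z₀ := a y with hz₀def
  have hz₀ : z₀ ∈ a.target := a.map_source hya
  have hay : a.symm z₀ = y := a.left_inv hya
  -- the three pieces
  have h1 : DifferentiableAt ℂ (c₀ ∘ a.symm) z₀ :=
    differentiableAt_chart_transition ha (chart_mem_atlas ℂ y) hz₀
      (by rw [hay]; exact mem_chart_source ℂ y)
  have h1v : (c₀ ∘ a.symm) z₀ = c₀ y := by simp only [comp_apply, hay]
  have h3 : DifferentiableAt ℂ (b ∘ d₀.symm) (d₀ (f y)) :=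
    differentiableAt_chart_transition (chart_mem_atlas ℂ (f y)) hb
      (d₀.map_source (mem_chart_source ℂ (f y)))
      (by rw [d₀.left_inv (mem_chart_source ℂ (f y))]; exact hyb)
  have h3' : DifferentiableAt ℂ (conj ∘ (b ∘ d₀.symm) ∘ conj) (conj (d₀ (f y))) := h3.conj_conj
  have h2v : (conj ∘ W) (c₀ y) = conj (d₀ (f y)) := by
    simp only [comp_apply, hW, c₀.left_inv (mem_chart_source ℂ y)]
  -- their composite is differentiable at `z₀`
  have h12 : DifferentiableAt ℂ ((conj ∘ W) ∘ (c₀ ∘ a.symm)) z₀ := by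
    refine DifferentiableAt.comp z₀ ?_ h1
    rw [h1v]
    exact hdiff
  have h12v : ((conj ∘ W) ∘ (c₀ ∘ a.symm)) z₀ = conj (d₀ (f y)) := by
    simp only [comp_apply, hay, hW, c₀.left_inv (mem_chart_source ℂ y)]
  have hcomp : DifferentiableAt ℂ
      ((conj ∘ (b ∘ d₀.symm) ∘ conj) ∘ ((conj ∘ W) ∘ (c₀ ∘ a.symm))) z₀ := by
    refine DifferentiableAt.comp z₀ ?_ h12
    rw [h12v]
    exact h3'
  -- and it agrees with `conj ∘ (b ∘ f ∘ a⁻¹)` near `z₀`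
  have e1 : ∀ᶠ z in 𝓝 z₀, a.symm z ∈ c₀.source := by
    have hc : ContinuousAt a.symm z₀ := a.continuousAt_symm hz₀
    refine hc.preimage_mem_nhds ?_
    rw [hay]
    exact c₀.open_source.mem_nhds (mem_chart_source ℂ y)
  have e2 : ∀ᶠ z in 𝓝 z₀, f (a.symm z) ∈ d₀.source := by
    have hc : ContinuousAt (f ∘ a.symm) z₀ := by
      refine ContinuousAt.comp ?_ (a.continuousAt_symm hz₀)
      rw [hay]; exact hcont
    refine hc.preimage_mem_nhds ?_
    rw [comp_apply, hay]
    exact d₀.open_source.mem_nhds (mem_chart_source ℂ (f y))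
  have hev : (conj ∘ (b ∘ f ∘ a.symm)) =ᶠ[𝓝 z₀]
      ((conj ∘ (b ∘ d₀.symm) ∘ conj) ∘ ((conj ∘ W) ∘ (c₀ ∘ a.symm))) := by
    filter_upwards [e1, e2] with z hz1 hz2
    simp only [comp_apply, hW, c₀.left_inv hz1, d₀.left_inv hz2, Complex.conj_conj]
  exact (hev.differentiableAt_iff).2 hcomp

/-! ### Composition rules -/

omit [IsManifold 𝓘(ℂ, ℂ) ω X] [IsManifold 𝓘(ℂ, ℂ) ω Y] [IsManifold 𝓘(ℂ, ℂ) ω Z] in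
/-- **hol ∘ hol = hol.** [cite: MochizukiAbsTopIII2015, Definition 2.1 (ii) p.51] -/
theorem IsHolAt.comp {g : Y → Z} {f : X → Y} {x : X} (hg : IsHolAt g (f x)) (hf : IsHolAt f x) :
    IsHolAt (g ∘ f) x := by
  have hg' : ∀ᶠ y in 𝓝 x, MDifferentiableAt 𝓘(ℂ, ℂ) 𝓘(ℂ, ℂ) g (f y) :=
    hf.continuousAt.eventually hg
  filter_upwards [hf, hg'] with y hfy hgy
  exact hgy.comp y hfy

omit [IsManifold 𝓘(ℂ, ℂ) ω X] [IsManifold 𝓘(ℂ, ℂ) ω Y] [IsManifold 𝓘(ℂ, ℂ) ω Z] in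
/-- The chart expression of a composite is, near the base point, the composite of the chart
expressions (Mathlib `writtenInExtChartAt_comp`, model `𝓘(ℂ, ℂ)`).
[cite: MochizukiAbsTopIII2015, Definition 2.1 (ii) p.51] -/
theorem writtenInExtChartAt_comp_eventuallyEq {g : Y → Z} {f : X → Y} {y : X}
    (hf : ContinuousAt f y) :
    writtenInExtChartAt 𝓘(ℂ, ℂ) 𝓘(ℂ, ℂ) y (g ∘ f) =ᶠ[𝓝 (extChartAt 𝓘(ℂ, ℂ) y y)]
      (writtenInExtChartAt 𝓘(ℂ, ℂ) 𝓘(ℂ, ℂ) (f y) g ∘ writtenInExtChartAt 𝓘(ℂ, ℂ) 𝓘(ℂ, ℂ) y f) := by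
  have hcomp := writtenInExtChartAt_comp (I := 𝓘(ℂ, ℂ)) (I' := 𝓘(ℂ, ℂ)) (I'' := 𝓘(ℂ, ℂ))
    (g := g) (s := univ) hf.continuousWithinAt
  rwa [preimage_univ, univ_inter, ModelWithCorners.Boundaryless.range_eq_univ,
    nhdsWithin_univ] at hcomp

omit [IsManifold 𝓘(ℂ, ℂ) ω X] [IsManifold 𝓘(ℂ, ℂ) ω Y] [IsManifold 𝓘(ℂ, ℂ) ω Z] in
/-- **anti ∘ anti = hol.** [cite: MochizukiAbsTopIII2015, Definition 2.1 (ii) p.51] -/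
theorem IsAntiHolAt.comp_isAntiHolAt {g : Y → Z} {f : X → Y} {x : X} (hg : IsAntiHolAt g (f x))
    (hf : IsAntiHolAt f x) : IsHolAt (g ∘ f) x := by
  have hg' : ∀ᶠ y in 𝓝 x, ContinuousAt g (f y) ∧
      DifferentiableAt ℂ (conj ∘ writtenInExtChartAt 𝓘(ℂ, ℂ) 𝓘(ℂ, ℂ) (f y) g)
        (extChartAt 𝓘(ℂ, ℂ) (f y) (f y)) :=
    hf.continuousAt.eventually hg
  filter_upwards [hf, hg'] with y hfy hgy
  obtain ⟨hfc, hfd⟩ := hfy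
  obtain ⟨hgc, hgd⟩ := hgy
  rw [mdifferentiableAt_iff]
  refine ⟨hgc.comp hfc, ?_⟩
  rw [ModelWithCorners.Boundaryless.range_eq_univ, differentiableWithinAt_univ]
  refine ((writtenInExtChartAt_comp_eventuallyEq (g := g) hfc).differentiableAt_iff).2 ?_
  have hsplit : (writtenInExtChartAt 𝓘(ℂ, ℂ) 𝓘(ℂ, ℂ) (f y) g ∘
      writtenInExtChartAt 𝓘(ℂ, ℂ) 𝓘(ℂ, ℂ) y f) =
      ((conj ∘ (conj ∘ writtenInExtChartAt 𝓘(ℂ, ℂ) 𝓘(ℂ, ℂ) (f y) g) ∘ conj) ∘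
        (conj ∘ writtenInExtChartAt 𝓘(ℂ, ℂ) 𝓘(ℂ, ℂ) y f)) := by
    funext w
    simp only [comp_apply, Complex.conj_conj]
  rw [hsplit]
  refine DifferentiableAt.comp _ ?_ hfd
  have hval : (conj ∘ writtenInExtChartAt 𝓘(ℂ, ℂ) 𝓘(ℂ, ℂ) y f) (extChartAt 𝓘(ℂ, ℂ) y y) =
      conj (extChartAt 𝓘(ℂ, ℂ) (f y) (f y)) := by
    rw [comp_apply, writtenInExtChartAt_apply_self, extChartAt_apply_eq]
  rw [hval]
  exact hgd.conj_conj

omit [IsManifold 𝓘(ℂ, ℂ) ω X] [IsManifold 𝓘(ℂ, ℂ) ω Y] [IsManifold 𝓘(ℂ, ℂ) ω Z] in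
/-- **hol ∘ anti = anti.** [cite: MochizukiAbsTopIII2015, Definition 2.1 (ii) p.51] -/
theorem IsHolAt.comp_isAntiHolAt {g : Y → Z} {f : X → Y} {x : X} (hg : IsHolAt g (f x))
    (hf : IsAntiHolAt f x) : IsAntiHolAt (g ∘ f) x := by
  have hg' : ∀ᶠ y in 𝓝 x, MDifferentiableAt 𝓘(ℂ, ℂ) 𝓘(ℂ, ℂ) g (f y) :=
    hf.continuousAt.eventually hg
  filter_upwards [hf, hg'] with y hfy hgd
  obtain ⟨hfc, hfd⟩ := hfy
  refine ⟨hgd.continuousAt.comp hfc, ?_⟩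
  refine (((writtenInExtChartAt_comp_eventuallyEq (g := g) hfc).fun_comp
    conj).differentiableAt_iff).2 ?_
  have hsplit : (conj ∘ (writtenInExtChartAt 𝓘(ℂ, ℂ) 𝓘(ℂ, ℂ) (f y) g ∘
      writtenInExtChartAt 𝓘(ℂ, ℂ) 𝓘(ℂ, ℂ) y f)) =
      ((conj ∘ writtenInExtChartAt 𝓘(ℂ, ℂ) 𝓘(ℂ, ℂ) (f y) g ∘ conj) ∘
        (conj ∘ writtenInExtChartAt 𝓘(ℂ, ℂ) 𝓘(ℂ, ℂ) y f)) := by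
    funext w
    simp only [comp_apply, Complex.conj_conj]
  rw [hsplit]
  refine DifferentiableAt.comp _ ?_ hfd
  have hval : (conj ∘ writtenInExtChartAt 𝓘(ℂ, ℂ) 𝓘(ℂ, ℂ) y f) (extChartAt 𝓘(ℂ, ℂ) y y) =
      conj (extChartAt 𝓘(ℂ, ℂ) (f y) (f y)) := by
    rw [comp_apply, writtenInExtChartAt_apply_self, extChartAt_apply_eq]
  rw [hval]
  exact (differentiableAt_writtenInExtChartAt hgd).conj_conj

omit [IsManifold 𝓘(ℂ, ℂ) ω X] [IsManifold 𝓘(ℂ, ℂ) ω Y] [IsManifold 𝓘(ℂ, ℂ) ω Z] in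
/-- **anti ∘ hol = anti.** [cite: MochizukiAbsTopIII2015, Definition 2.1 (ii) p.51] -/
theorem IsAntiHolAt.comp_isHolAt {g : Y → Z} {f : X → Y} {x : X} (hg : IsAntiHolAt g (f x))
    (hf : IsHolAt f x) : IsAntiHolAt (g ∘ f) x := by
  have hg' : ∀ᶠ y in 𝓝 x, ContinuousAt g (f y) ∧
      DifferentiableAt ℂ (conj ∘ writtenInExtChartAt 𝓘(ℂ, ℂ) 𝓘(ℂ, ℂ) (f y) g)
        (extChartAt 𝓘(ℂ, ℂ) (f y) (f y)) :=
    hf.continuousAt.eventually hg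
  filter_upwards [hf, hg'] with y hfd hgy
  obtain ⟨hgc, hgd⟩ := hgy
  have hfc : ContinuousAt f y := hfd.continuousAt
  refine ⟨hgc.comp hfc, ?_⟩
  refine (((writtenInExtChartAt_comp_eventuallyEq (g := g) hfc).fun_comp
    conj).differentiableAt_iff).2 ?_
  have hsplit : (conj ∘ (writtenInExtChartAt 𝓘(ℂ, ℂ) 𝓘(ℂ, ℂ) (f y) g ∘
      writtenInExtChartAt 𝓘(ℂ, ℂ) 𝓘(ℂ, ℂ) y f)) =
      ((conj ∘ writtenInExtChartAt 𝓘(ℂ, ℂ) 𝓘(ℂ, ℂ) (f y) g) ∘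
        writtenInExtChartAt 𝓘(ℂ, ℂ) 𝓘(ℂ, ℂ) y f) := rfl
  rw [hsplit]
  refine DifferentiableAt.comp _ ?_ (differentiableAt_writtenInExtChartAt hfd)
  rw [writtenInExtChartAt_apply_self, ← extChartAt_apply_eq]
  exact hgd

end Calculus

end Literature.AnabelianGeometry.AbsoluteAnabelian
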